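import Mathlib
import Summits.MatrixMultiplication.MatrixMultiplication.Theorems.SoloInformedValTriforceAnswer

/-!
# SoloInformedValSkewCorner — skew-corner free subsets of `Δ_n` of size `n^{2-o(1)}` (Pratt Def. 4.12)

Pratt [arXiv:2309.03878 (ITCS 2024, LIPIcs 287:89), Def. 4.12 (a notion suggested by O'Donnell), Prop. 4.13]:
`S ⊆ Δ_n` is *skew-corner free* if for `(a,b,c), (a,b',c') ∈ S` it holds that `(a+b-b', b'', c'') ∉ S` for all
`b'', c''`, and this remains true after any permutation of the coordinates; the largest skew-corner free subset of
`Δ_{n+1}` is at least `Val(△, n)` (Prop. 4.13); and "the best lower bound that we know on the size of the largest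
skew-corner free subset of `Δ_n` is `Ω(n)`; … it is not hard to improve this to `3n/2`.  We have found examples
exceeding these bounds with computer search."

* `SkewCornerFree` — Def. 4.12 for finite sets of points `Fin 3 → ℤ`.  The clause indexed by an ordered pair of
  distinct coordinates `(i, j)` is Def. 4.12 after the permutation of coordinates that puts the shared coordinate in
  position `i` and the differenced coordinate in position `j`; the two points are taken distinct (for equal points
  Def. 4.12 would forbid the point itself).
* `TriforceFree.skewCornerFree` — Prop. 4.13 at every target: the solution set `tripleSet A B C t` of a
  triforce-free triple (Def. 4.10, file `SoloInformedValTriforce`) is skew-corner free.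
* `skewCornerFree_lower_bound` — for every `ε > 0` and all large `N` there is a skew-corner free
  `S ⊆ Δ_{N+1} = {p ∈ ℤ_{≥ 0}^3 : p₀ + p₁ + p₂ = N}` with `#S ≥ N^{2-ε}` (from `val_triforce_lower_bound`): the largest
  skew-corner free subset of `Δ_n` has size `n^{2-o(1)}`, not `O(n)`.  Standard axioms only.
-/

namespace Summit.MatrixMultiplication.MatrixMultiplication.Theorems.SoloVal

open Finset

/-! ### Solution sets as point sets in `ℤ³` -/

/-- The solution set of `(A, B, C)` at target `t` as a set of points of `ℤ³` (in the plane `p₀ + p₁ + p₂ = t`). -/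
noncomputable def tripleSet (A B C : Finset ℤ) (t : ℤ) : Finset (Fin 3 → ℤ) :=
  (solutions A B C t).image (fun p => ![p.1, p.2.1, p.2.2])

/-- Membership in `tripleSet`, coordinatewise. -/
theorem mem_tripleSet {A B C : Finset ℤ} {t : ℤ} {X : Fin 3 → ℤ} :
    X ∈ tripleSet A B C t ↔ X 0 ∈ A ∧ X 1 ∈ B ∧ X 2 ∈ C ∧ X 0 + X 1 + X 2 = t := by
  constructor
  · intro h
    rw [tripleSet, mem_image] at h
    obtain ⟨⟨a, b, c⟩, habc, rfl⟩ := h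
    simp only [solutions, mem_filter, mem_product] at habc
    simpa [and_assoc] using habc
  · rintro ⟨h0, h1, h2, hs⟩
    rw [tripleSet, mem_image]
    refine ⟨(X 0, X 1, X 2), ?_, ?_⟩
    · simp only [solutions, mem_filter, mem_product]
      exact ⟨⟨h0, h1, h2⟩, hs⟩
    · funext l
      fin_cases l <;> rfl

/-- `tripleSet` has as many points as there are solutions. -/
theorem card_tripleSet (A B C : Finset ℤ) (t : ℤ) : #(tripleSet A B C t) = #(solutions A B C t) := by
  apply card_image_of_injective
  intro p q h
  have h0 : p.1 = q.1 := congrFun h 0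
  have h1 : p.2.1 = q.2.1 := congrFun h 1
  have h2 : p.2.2 = q.2.2 := congrFun h 2
  exact Prod.ext h0 (Prod.ext h1 h2)

/-! ### Definition 4.12 -/

/-- **Skew-corner freeness** [Pratt, arXiv:2309.03878, Def. 4.12] of a finite point set `S ⊆ ℤ³`: for all distinct
coordinates `i ≠ j` and all distinct `p, q ∈ S` with `p i = q i`, no point `u ∈ S` has `u i = p i + (p j - q j)` — i.e.
two distinct points on a line `{xᵢ = a}` whose `j`-th coordinates differ by `δ` empty the whole line `{xᵢ = a + δ}`.
(Def. 4.12 states the clause `(i, j) = (0, 1)` — "`(a,b,c), (a,b',c') ∈ S ⟹ (a+b-b', b'', c'') ∉ S` for all `b'', c''`"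
— "and this remains true after any permutation of the coordinates"; the clause for `(i, j)` is the one obtained from
the permutation taking coordinate `i` to the first and coordinate `j` to the second position.) -/
def SkewCornerFree (S : Finset (Fin 3 → ℤ)) : Prop :=
  ∀ i j : Fin 3, i ≠ j → ∀ p ∈ S, ∀ q ∈ S, p i = q i → p ≠ q → ∀ u ∈ S, u i ≠ p i + (p j - q j)

/-! ### Proposition 4.13 at every target -/

/-- Three solutions pairwise sharing the `A`-, the `B`- and the `C`-coordinate coincide (the content of Def. 4.10
for point sets). -/
theorem triforce_points {A B C : Finset ℤ} {t : ℤ} (h : TriforceFree A B C t) {X Y Z : Fin 3 → ℤ}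
    (hX : X ∈ tripleSet A B C t) (hY : Y ∈ tripleSet A B C t) (hZ : Z ∈ tripleSet A B C t)
    (h0 : X 0 = Y 0) (h1 : X 1 = Z 1) (h2 : Y 2 = Z 2) : X = Y ∧ X = Z := by
  rw [mem_tripleSet] at hX hY hZ
  obtain ⟨hX0, hX1, hX2, hXs⟩ := hX
  obtain ⟨hY0, hY1, hY2, hYs⟩ := hY
  obtain ⟨hZ0, hZ1, hZ2, hZs⟩ := hZ
  have key : X 0 = Z 0 ∨ X 1 = Y 1 ∨ Y 2 = X 2 :=
    h (X 0) hX0 (Z 0) hZ0 (X 1) hX1 (Y 1) hY1 (Y 2) hY2 (X 2) hX2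
      (by linarith) (by linarith) (by linarith)
  have e : (X 0 = Y 0 ∧ X 1 = Y 1 ∧ X 2 = Y 2) ∧ (X 0 = Z 0 ∧ X 1 = Z 1 ∧ X 2 = Z 2) := by
    rcases key with k | k | k <;> refine ⟨⟨?_, ?_, ?_⟩, ?_, ?_, ?_⟩ <;> linarith
  obtain ⟨⟨e0, e1, e2⟩, f0, f1, f2⟩ := e
  constructor
  · funext l
    obtain rfl | rfl | rfl : l = 0 ∨ l = 1 ∨ l = 2 := by fin_cases l <;> simp
    exacts [e0, e1, e2]
  · funext l
    obtain rfl | rfl | rfl : l = 0 ∨ l = 1 ∨ l = 2 := by fin_cases l <;> simp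
    exacts [f0, f1, f2]

/-- **[Pratt, Prop. 4.13], at every target `t`:** the solution set of a triforce-free triple is skew-corner free.
(Given `p, q` on a line `{xᵢ = a}` and `u` on the forbidden parallel line, the point with `i`-th coordinate from `u`,
`j`-th from `q` and the remaining one from `p` is again a solution, and with `p, q` it forms a triforce.) -/
theorem TriforceFree.skewCornerFree {A B C : Finset ℤ} {t : ℤ} (h : TriforceFree A B C t) :
    SkewCornerFree (tripleSet A B C t) := by
  intro i j hij p hp q hq hpq hne u hu hu'
  have hp' := mem_tripleSet.1 hp
  have hq' := mem_tripleSet.1 hq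
  have hu₀ := mem_tripleSet.1 hu
  obtain ⟨hp0, hp1, hp2, hps⟩ := hp'
  obtain ⟨hq0, hq1, hq2, hqs⟩ := hq'
  obtain ⟨hu0, hu1, hu2, hus⟩ := hu₀
  obtain rfl | rfl | rfl : i = 0 ∨ i = 1 ∨ i = 2 := by fin_cases i <;> simp
  all_goals obtain rfl | rfl | rfl : j = 0 ∨ j = 1 ∨ j = 2 := by fin_cases j <;> simp
  all_goals first | exact absurd rfl hij | skip
  · -- (i, j) = (0, 1): fourth point `(u₀, q₁, p₂)`; triforce `X = q, Y = p, Z = w`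
    have hw : ![u 0, q 1, p 2] ∈ tripleSet A B C t :=
      mem_tripleSet.2 ⟨hu0, hq1, hp2, by show u 0 + q 1 + p 2 = t; linarith⟩
    obtain ⟨e, -⟩ := triforce_points h hq hp hw hpq.symm rfl rfl
    exact hne e.symm
  · -- (0, 2): `(u₀, p₁, q₂)`; `X = p, Y = q, Z = w`
    have hw : ![u 0, p 1, q 2] ∈ tripleSet A B C t :=
      mem_tripleSet.2 ⟨hu0, hp1, hq2, by show u 0 + p 1 + q 2 = t; linarith⟩
    obtain ⟨e, -⟩ := triforce_points h hp hq hw hpq rfl rfl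
    exact hne e
  · -- (1, 0): `(q₀, u₁, p₂)`; `X = q, Y = w, Z = p`
    have hw : ![q 0, u 1, p 2] ∈ tripleSet A B C t :=
      mem_tripleSet.2 ⟨hq0, hu1, hp2, by show q 0 + u 1 + p 2 = t; linarith⟩
    obtain ⟨-, e⟩ := triforce_points h hq hw hp rfl hpq.symm rfl
    exact hne e.symm
  · -- (1, 2): `(p₀, u₁, q₂)`; `X = p, Y = w, Z = q`
    have hw : ![p 0, u 1, q 2] ∈ tripleSet A B C t :=
      mem_tripleSet.2 ⟨hp0, hu1, hq2, by show p 0 + u 1 + q 2 = t; linarith⟩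
    obtain ⟨-, e⟩ := triforce_points h hp hw hq rfl hpq rfl
    exact hne e
  · -- (2, 0): `(q₀, p₁, u₂)`; `X = w, Y = q, Z = p`
    have hw : ![q 0, p 1, u 2] ∈ tripleSet A B C t :=
      mem_tripleSet.2 ⟨hq0, hp1, hu2, by show q 0 + p 1 + u 2 = t; linarith⟩
    obtain ⟨e, f⟩ := triforce_points h hw hq hp rfl rfl hpq.symm
    exact hne (f.symm.trans e)
  · -- (2, 1): `(p₀, q₁, u₂)`; `X = w, Y = p, Z = q`
    have hw : ![p 0, q 1, u 2] ∈ tripleSet A B C t :=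
      mem_tripleSet.2 ⟨hp0, hq1, hu2, by show p 0 + q 1 + u 2 = t; linarith⟩
    obtain ⟨e, f⟩ := triforce_points h hw hp hq rfl rfl hpq
    exact hne (e.symm.trans f)

/-! ### The lower bound -/

/-- **Skew-corner free subsets of `Δ_n` of size `n^{2-o(1)}` [the "best lower bound `Ω(n)`" after Prop. 4.13].**
For every `ε > 0` and all sufficiently large `N` there is a skew-corner free set of points of
`Δ_{N+1} = {p ∈ ℤ³ : 0 ≤ pₗ ≤ N, p₀ + p₁ + p₂ = N}` with at least `N^{2-ε}` points. -/
theorem skewCornerFree_lower_bound (ε : ℝ) (hε : 0 < ε) :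
    ∃ N₀ : ℕ, ∀ N : ℕ, N₀ ≤ N → ∃ S : Finset (Fin 3 → ℤ),
      (∀ p ∈ S, (∀ l, 0 ≤ p l ∧ p l ≤ N) ∧ p 0 + p 1 + p 2 = N) ∧ SkewCornerFree S ∧
      (N : ℝ) ^ (2 - ε) ≤ #S := by
  obtain ⟨N₀, hN₀⟩ := val_triforce_lower_bound ε hε
  refine ⟨N₀, fun N hN => ?_⟩
  obtain ⟨A, B, C, hA, hB, hC, hfree, hcount⟩ := hN₀ N hN
  refine ⟨tripleSet A B C N, ?_, hfree.skewCornerFree, ?_⟩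
  · intro p hp
    obtain ⟨h0, h1, h2, hs⟩ := mem_tripleSet.1 hp
    have b0 := mem_Icc.1 (hA h0)
    have b1 := mem_Icc.1 (hB h1)
    have b2 := mem_Icc.1 (hC h2)
    refine ⟨fun l => ?_, hs⟩
    obtain rfl | rfl | rfl : l = 0 ∨ l = 1 ∨ l = 2 := by fin_cases l <;> simp
    exacts [b0, b1, b2]
  · rw [card_tripleSet]
    exact hcount

end Summit.MatrixMultiplication.MatrixMultiplication.Theorems.SoloVal
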